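import Mathlib.Analysis.Calculus.MeanValue
import Mathlib.Analysis.Calculus.ContDiff.RCLike
import Mathlib.Analysis.Complex.CauchyIntegral
import Mathlib.MeasureTheory.Integral.IntervalIntegral.FundThmCalculus
import Literature.Probability.RandomPlanarGeometry.LoewnerGrowth
import HarnessLib

/-!
# The Loewner map `g_t` in the starting point: continuous dependence, derivative, hull radius

Theorems on the chordal Loewner chain of
`Literature.Probability.RandomPlanarGeometry.LoewnerChain` (driving function `W`, solutions
`IsSolution`, swallowing times `T_z = swallowingTime W z`, hulls `K_t = hull W t`, domains
`H_t = domain W t = ℍₒ ∖ K_t`, Loewner map `g_t = map W t`), continuing `LoewnerChainProofs`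
(Picard–Lindelöf, maximal solutions, extension criterion, lower semicontinuity of `T_z`),
`LoewnerFlow` (the backward flow; `g_t : H_t → ℍₒ` is a conformal equivalence,
`exists_conformalEquiv_map_holds`, Lawler (2005), Thm. 4.6; `map_eq_of_isSolution`) and
`LoewnerGrowth` (far field `lt_swallowingTime_of_far`, hydrodynamic normalisation, the cocycle
`map_add`, strict growth `hull_ssubset_hull`):

* **The forward map in the starting point** (Lawler (2005), proof of Thm. 4.6, eqs.
  (4.6)–(4.8), here for the forward flow and for *all* starting points still flowing, real ones
  included): for two solutions `Δ_t = g_t(z₂) - g_t(z₁)` solves the linear equation `Δ̇ = a Δ`,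
  `a = -2/((g_t(z₂) - W_t)(g_t(z₁) - W_t))`, so `Δ_t = (z₂ - z₁) exp ∫₀ᵗ a`
  (`IsSolution.sub_eq_mul_exp`), which gives injectivity on all of `{z | t < T_z}`
  (`injOn_map_of_lt_swallowingTime`; `LoewnerFlow.injOn_map` is the case `H_t`), **continuous
  dependence on the starting point** up to a fixed time (Lawler's (4.7);
  `IsSolution.exists_forall_dist_lt`, by Grönwall) and the **complex derivative**
  `g_t'(z) = exp(-∫₀ᵗ 2 ds/(g_s(z) - W_s)²)` at every point still flowing, real points included
  (`hasDerivAt_map`, `differentiableOn_map_of_lt_swallowingTime`, `continuousAt_map`;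
  non-vanishing strict derivative `exists_hasStrictDerivAt_map`); `im_map_le`.
* `Literature.Probability.RandomPlanarGeometry.Loewner.norm_sub_driving_le_of_swallowingTime_le` — the **radius of the swallowed set**
  (Lawler (2005), Lemma 4.13, `rad(K_t) ≤ 4 max{√t, sup_{s≤t}|U_s - U_0|}`): any point
  `z ≠ W_0` of the plane, real points included, with `T_z ≤ u` is within
  `sup_{s≤u}|W_s - W_0| + 4√u` of `W_0` (the far field `lt_swallowingTime_of_far` of
  `LoewnerGrowth` read contrapositively); `norm_sub_driving_le_of_mem_hull`,
  `hull_subset_closedBall_driving`: `K_u ⊆ B̄(W_0, sup_{s≤u}|W_s - W_0| + 4√u)`, so `K_u → W_0` as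
  `u → 0`; translation invariance `IsSolution.add_const`, `swallowingTime_add_const`.
* `Literature.Probability.RandomPlanarGeometry.Loewner.hull_neg`, `IsGeneratedByCurve.neg_conj` — the reflection `z ↦ -z̄`, `W ↦ -W`
  maps hulls to hulls and generating curves to generating curves.
* `Literature.Probability.RandomPlanarGeometry.Loewner.hull_ne_hull` — `K_s ≠ K_t` for `s < t`, the form of strict growth
  (`hull_ssubset_hull` of `LoewnerGrowth`, Lawler (2005), Thm. 4.6: `hcap(K_t) = 2t`) consumed by
  `SLEBoundaryHittingProofs` ("the trace cannot crawl along the real axis without growing the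
  hull").

## Mathlib

We USE `dist_le_of_trajectories_ODE_of_mem` (Grönwall), `Continuous.integral_hasStrictDerivAt`
(FTC for the continuous extension `Set.IccExtend` of the coefficient `a`),
`intervalIntegral.norm_integral_le_of_norm_le_const`, `hasDerivAt_iff_tendsto_slope`,
`DifferentiableOn.analyticAt`, `ContDiffAt.hasStrictDerivAt'`,
`IsCompact.exists_bound_of_continuousOn`, `Homeomorph.image_connectedComponentIn` (for
`Complex.conjLIE.toHomeomorph.trans (Homeomorph.neg ℂ)`). Mathlib has no differentiable
dependence of ODE solutions on initial data; the explicit linear equation for differences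
replaces it here.

## References

* G. F. Lawler, *Conformally Invariant Processes in the Plane*, AMS Math. Surveys 114 (2005),
  Ch. 4 §4.1: Thm. 4.6 with eqs. (4.5)–(4.8) (the maps `g_t`, `Δ_t(z, w)`, `g_t'`),
  Lemma 4.13 (`rad(K_t) ≤ 4R_t`).
-/

noncomputable section

namespace Literature.Probability.RandomPlanarGeometry

namespace Loewner

open Set Filter Topology Metric
open UpperHalfPlane (upperHalfPlaneSet isOpen_upperHalfPlaneSet)
open scoped NNReal ComplexConjugate

variable {W : ℝ≥0 → ℝ} {z : ℂ} {g : ℝ → ℂ} {T : WithTop ℝ≥0}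

/-! ### Continuous dependence of the flow on the starting point -/

section ContinuousDependence

/-- **Tube estimate.** Let `g` be a solution from `z` alive on `[0, b]` and `δ`-away from `W`
there, and `0 < ε ≤ δ/2`. A solution `h` from a point `z'` with
`dist z' z < (ε/2) e^{-K b}`, `K = 2/(δ/2)²` (the Lipschitz constant of the field on the
`δ/2`-tube), alive on `[0, u] ⊆ [0, b]`, stays `ε`-close to `g` on `[0, u]`: as long as it is
`ε`-close it is `δ/2`-away from `W`, so Grönwall's inequality
(`dist_le_of_trajectories_ODE_of_mem`) bounds the distance by `(ε/2) e^{-K b} e^{K s} ≤ ε/2`, and a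
first-exit argument concludes. [cite: Lawler2005, Ch. 4 §4.1] -/
theorem IsSolution.dist_lt_of_dist_lt (hg : IsSolution W z g T) {b : ℝ}
    (hbT : (b.toNNReal : WithTop ℝ≥0) < T) {δ : ℝ≥0} (hδ : 0 < δ)
    (hfar : ∀ t ∈ Icc 0 b, (δ : ℝ) ≤ ‖g t - W t.toNNReal‖) {ε : ℝ} (hε : 0 < ε)
    (hεδ : ε ≤ δ / 2) {z' : ℂ} {h : ℝ → ℂ} {T' : WithTop ℝ≥0} (hh : IsSolution W z' h T')
    (hz' : dist z' z < ε / 2 * Real.exp (-(2 / ((δ : ℝ) / 2) ^ 2 * b)))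
    {u : ℝ} (hub : u ≤ b) (huT' : (u.toNNReal : WithTop ℝ≥0) < T') :
    ∀ s ∈ Icc 0 u, dist (h s) (g s) < ε := by
  have hδ' : (0 : ℝ) < δ := hδ
  set K : ℝ≥0 := 2 / (δ / 2) ^ 2 with hKdef
  have hK : (K : ℝ) = 2 / ((δ : ℝ) / 2) ^ 2 := by
    rw [hKdef]; push_cast; ring
  have hsubg : Icc 0 b ⊆ {t : ℝ | 0 ≤ t ∧ (t.toNNReal : WithTop ℝ≥0) < T} :=
    Icc_subset_timeDomain hbT
  have hsubh : Icc 0 u ⊆ {t : ℝ | 0 ≤ t ∧ (t.toNNReal : WithTop ℝ≥0) < T'} :=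
    Icc_subset_timeDomain huT'
  intro s₁ hs₁
  by_contra hnot
  rw [not_lt] at hnot
  have hu0 : 0 ≤ u := hs₁.1.trans hs₁.2
  have hsubg' : Icc 0 u ⊆ Icc 0 b := Icc_subset_Icc le_rfl hub
  have hconth : ContinuousOn h (Icc 0 u) := hh.continuousOn.mono hsubh
  have hcontg : ContinuousOn g (Icc 0 u) := hg.continuousOn.mono (hsubg'.trans hsubg)
  have hcontd : ContinuousOn (fun s ↦ dist (h s) (g s)) (Icc 0 u) :=
    continuous_dist.comp_continuousOn (hconth.prodMk hcontg)
  set S : Set ℝ := Icc 0 u ∩ (fun s ↦ dist (h s) (g s)) ⁻¹' Ici ε with hSdef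
  have hS : IsClosed S := hcontd.preimage_isClosed_of_isClosed isClosed_Icc isClosed_Ici
  have huS : s₁ ∈ S := ⟨hs₁, hnot⟩
  have hSbdd : BddBelow S := ⟨0, fun s hs ↦ hs.1.1⟩
  set s₀ := sInf S with hs₀def
  have hs₀S : s₀ ∈ S := hS.csInf_mem ⟨s₁, huS⟩ hSbdd
  have hs₀0 : 0 ≤ s₀ := hs₀S.1.1
  have hs₀u : s₀ ≤ u := hs₀S.1.2
  have hbefore : ∀ s, 0 ≤ s → s < s₀ → dist (h s) (g s) < ε := by
    intro s hs0 hss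
    by_contra hge
    rw [not_lt] at hge
    have hsS : s ∈ S := ⟨⟨hs0, hss.le.trans hs₀u⟩, hge⟩
    exact absurd (csInf_le hSbdd hsS) (not_le.2 hss)
  -- Grönwall on `[0, s₀]`
  have hsub0 : Icc 0 s₀ ⊆ Icc 0 u := Icc_subset_Icc le_rfl hs₀u
  have key := dist_le_of_trajectories_ODE_of_mem (v := vectorField W)
    (s := fun t ↦ {w : ℂ | ((δ / 2 : ℝ≥0) : ℝ) ≤ ‖w - W t.toNNReal‖}) (K := K)
    (δ := ε / 2 * Real.exp (-(2 / ((δ : ℝ) / 2) ^ 2 * b)))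
    (f := g) (g := h) (a := 0) (b := s₀)
    (fun t _ ↦ by rw [hKdef]; exact lipschitzOnWith_vectorField W t (half_pos hδ))
    (hcontg.mono hsub0) (hg.hasDerivWithinAt_Ici ((hsub0.trans hsubg').trans hsubg))
    (fun s hs ↦ by
      have := hfar s ⟨hs.1, hs.2.le.trans (hs₀u.trans hub)⟩
      show ((δ / 2 : ℝ≥0) : ℝ) ≤ _
      push_cast
      linarith)
    (hconth.mono hsub0) (hh.hasDerivWithinAt_Ici (hsub0.trans hsubh))
    (fun s hs ↦ by
      have h1 := hfar s ⟨hs.1, hs.2.le.trans (hs₀u.trans hub)⟩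
      have h2 := hbefore s hs.1 hs.2
      rw [dist_eq_norm] at h2
      show ((δ / 2 : ℝ≥0) : ℝ) ≤ _
      push_cast
      have h3 : ‖g s - (W s.toNNReal : ℂ)‖ ≤ ‖h s - W s.toNNReal‖ + ‖h s - g s‖ := by
        calc ‖g s - (W s.toNNReal : ℂ)‖ = ‖(h s - W s.toNNReal) - (h s - g s)‖ := by ring_nf
          _ ≤ _ := norm_sub_le _ _
      linarith)
    (by rw [hg.apply_zero, hh.apply_zero, dist_comm]; exact hz'.le)
  have hend := key s₀ ⟨hs₀0, le_rfl⟩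
  rw [sub_zero] at hend
  have hexp : ε / 2 * Real.exp (-(2 / ((δ : ℝ) / 2) ^ 2 * b)) * Real.exp (K * s₀) ≤ ε / 2 := by
    rw [mul_assoc, ← Real.exp_add, hK]
    have : Real.exp (-(2 / ((δ : ℝ) / 2) ^ 2 * b) + 2 / ((δ : ℝ) / 2) ^ 2 * s₀) ≤ 1 :=
      Real.exp_le_one_iff.2 (by
        have : 2 / ((δ : ℝ) / 2) ^ 2 * s₀ ≤ 2 / ((δ : ℝ) / 2) ^ 2 * b :=
          mul_le_mul_of_nonneg_left (hs₀u.trans hub) (by positivity)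
        linarith)
    nlinarith
  have hS₀ : ε ≤ dist (h s₀) (g s₀) := hs₀S.2
  rw [dist_comm] at hS₀
  linarith

/-- **Continuous dependence on the starting point, up to a fixed time.** Let `g` solve the
Loewner equation from `z` with lifetime `T > b` (continuous driving function). For every `ε > 0`
there is `ρ > 0` such that every `z'` with `dist z' z < ρ` is still flowing at time `b`
(`b < T_{z'}`) and every solution from `z'` is `ε`-close to `g` on `[0, b]` while alive. Proof:
`g` is `δ`-away from `W` on `[0, b]` (`IsSolution.exists_le_norm_sub`); with `ε' = min ε (δ/2)`
and `ρ = (ε'/2) e^{-K b}` the tube estimate `IsSolution.dist_lt_of_dist_lt` applies, and a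
maximal solution dying at or before `b` would stay `δ/2`-away from `W`, contradicting the
extension criterion `IsSolution.coe_lt_swallowingTime_of_le_norm_sub`. Lawler (2005), Ch. 4 §4.1
(continuity of `z ↦ g_t(z)`). [cite: Lawler2005, Ch. 4 §4.1] -/
theorem IsSolution.exists_forall_dist_lt (hW : Continuous W) (hg : IsSolution W z g T)
    {b : ℝ≥0} (hbT : (b : WithTop ℝ≥0) < T) {ε : ℝ} (hε : 0 < ε) :
    ∃ ρ > 0, ∀ z' : ℂ, dist z' z < ρ →
      (b : WithTop ℝ≥0) < swallowingTime W z' ∧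
      ∀ (h : ℝ → ℂ) (T' : WithTop ℝ≥0), IsSolution W z' h T' →
        ∀ s : ℝ, 0 ≤ s → s ≤ b → (s.toNNReal : WithTop ℝ≥0) < T' → dist (h s) (g s) < ε := by
  have hbT' : (((b : ℝ)).toNNReal : WithTop ℝ≥0) < T := by rwa [Real.toNNReal_coe]
  obtain ⟨δ, hδ, hfar⟩ := hg.exists_le_norm_sub hW b.coe_nonneg hbT'
  have hδ' : (0 : ℝ) < δ := hδ
  set ε' : ℝ := min ε (δ / 2) with hε'def
  have hε' : 0 < ε' := lt_min hε (half_pos hδ')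
  have hε'ε : ε' ≤ ε := min_le_left _ _
  have hε'δ : ε' ≤ δ / 2 := min_le_right _ _
  set ρ : ℝ := ε' / 2 * Real.exp (-(2 / ((δ : ℝ) / 2) ^ 2 * b)) with hρdef
  have hρ : 0 < ρ := by positivity
  refine ⟨ρ, hρ, fun z' hz' ↦ ⟨?_, fun h T' hh s hs0 hsb hsT' ↦ ?_⟩⟩
  · -- `z'` is off the singularity
    have hρε : ρ ≤ ε' / 2 := by
      rw [hρdef]
      have : Real.exp (-(2 / ((δ : ℝ) / 2) ^ 2 * b)) ≤ 1 := Real.exp_le_one_iff.2 (by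
        have : (0 : ℝ) ≤ 2 / ((δ : ℝ) / 2) ^ 2 * b := by positivity
        linarith)
      nlinarith
    have hz'0 : z' ≠ W 0 := by
      intro h0
      have h1 := hfar 0 ⟨le_rfl, b.coe_nonneg⟩
      rw [hg.apply_zero, Real.toNNReal_zero] at h1
      have h2 : ‖z - (W 0 : ℂ)‖ ≤ dist z' z := by
        rw [← h0, dist_comm, dist_eq_norm]
      linarith
    obtain ⟨h, hh⟩ := exists_isSolution_swallowingTime_holds hW hz'0
    by_contra hcon
    rw [not_lt] at hcon
    have hcT : swallowingTime W z' ≠ ⊤ := ne_top_of_le_ne_top WithTop.coe_ne_top hcon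
    obtain ⟨c, hc⟩ := WithTop.ne_top_iff_exists.1 hcT
    rw [← hc] at hh hcon
    have hcb : c ≤ b := WithTop.coe_le_coe.1 hcon
    have hc0 : 0 < c := by
      have := swallowingTime_pos_holds hW hz'0
      rw [← hc] at this
      exact WithTop.coe_pos.1 this
    have hfar' : ∀ u : ℝ, 0 ≤ u → u < c → ((δ / 2 : ℝ≥0) : ℝ) ≤ ‖h u - W u.toNNReal‖ := by
      intro u hu0 huc
      have hucT : (u.toNNReal : WithTop ℝ≥0) < (c : WithTop ℝ≥0) :=
        (mem_timeDomain_coe_iff.2 ⟨hu0, huc⟩).2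
      have hub : u ≤ b := huc.le.trans (NNReal.coe_le_coe.2 hcb)
      have h2 := hg.dist_lt_of_dist_lt hbT' hδ hfar hε' hε'δ hh hz' hub hucT u ⟨hu0, le_rfl⟩
      have h1 := hfar u ⟨hu0, hub⟩
      rw [dist_eq_norm] at h2
      push_cast
      have h3 : ‖g u - (W u.toNNReal : ℂ)‖ ≤ ‖h u - W u.toNNReal‖ + ‖h u - g u‖ := by
        calc ‖g u - (W u.toNNReal : ℂ)‖ = ‖(h u - W u.toNNReal) - (h u - g u)‖ := by ring_nf
          _ ≤ _ := norm_sub_le _ _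
      linarith
    have := hh.coe_lt_swallowingTime_of_le_norm_sub hW hc0 (half_pos hδ) hfar'
    rw [← hc] at this
    exact lt_irrefl _ this
  · exact (hg.dist_lt_of_dist_lt hbT' hδ hfar hε' hε'δ hh hz' hsb hsT' s ⟨hs0, le_rfl⟩).trans_le
      hε'ε

end ContinuousDependence

/-! ### The difference of two solutions: `g₂(b) - g₁(b) = (z₂ - z₁) · exp ∫₀ᵇ a` -/

section Difference

/-- The logarithmic derivative `a(s) = -2/((g₂ s - W s)(g₁ s - W s))` of the difference of two
solutions is continuous on a common compact time interval `[0, b]`. [folklore] -/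
theorem IsSolution.continuousOn_coeff (hW : Continuous W) {z₁ z₂ : ℂ} {g₁ g₂ : ℝ → ℂ}
    {T₁ T₂ : WithTop ℝ≥0} (h₁ : IsSolution W z₁ g₁ T₁) (h₂ : IsSolution W z₂ g₂ T₂) {b : ℝ}
    (hb₁ : (b.toNNReal : WithTop ℝ≥0) < T₁) (hb₂ : (b.toNNReal : WithTop ℝ≥0) < T₂) :
    ContinuousOn (fun s ↦ -2 / ((g₂ s - W s.toNNReal) * (g₁ s - W s.toNNReal))) (Icc 0 b) := by
  have hWc : Continuous fun s : ℝ ↦ (W s.toNNReal : ℂ) :=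
    Complex.continuous_ofReal.comp (hW.comp continuous_real_toNNReal)
  refine continuousOn_const.div (((h₂.continuousOn.mono (Icc_subset_timeDomain hb₂)).sub
    hWc.continuousOn).mul ((h₁.continuousOn.mono (Icc_subset_timeDomain hb₁)).sub
    hWc.continuousOn)) fun s hs ↦ ?_
  exact mul_ne_zero (sub_ne_zero.2 (h₂.ne hs.1 (Icc_subset_timeDomain hb₂ hs).2))
    (sub_ne_zero.2 (h₁.ne hs.1 (Icc_subset_timeDomain hb₁ hs).2))

/-- **The difference of two solutions solves a linear equation**: for solutions `g₁`, `g₂` of the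
Loewner equation (continuous driving function) from `z₁`, `z₂`, both alive on `[0, b]`,
`g₂(b) - g₁(b) = (z₂ - z₁) · exp (∫₀ᵇ a(s) ds)` with `a = -2/((g₂ - W)(g₁ - W))`, because
`d/ds (g₂ - g₁) = 2/(g₂ - W) - 2/(g₁ - W) = a · (g₂ - g₁)`, so `(g₂ - g₁) e^{-∫₀ˢ a}` has zero
derivative (`constant_of_has_deriv_right_zero`; the integral is differentiated through a
continuous extension of `a` beyond `[0, b]`, `Continuous.integral_hasStrictDerivAt`). This is
the source of both the injectivity and the holomorphy of `z ↦ g_t(z)`. Lawler (2005), Ch. 4 §4.1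
(proof that `g_t` is a conformal transformation). [cite: Lawler2005, Ch. 4 §4.1] -/
theorem IsSolution.sub_eq_mul_exp (hW : Continuous W) {z₁ z₂ : ℂ} {g₁ g₂ : ℝ → ℂ}
    {T₁ T₂ : WithTop ℝ≥0} (h₁ : IsSolution W z₁ g₁ T₁) (h₂ : IsSolution W z₂ g₂ T₂) {b : ℝ}
    (hb0 : 0 ≤ b) (hb₁ : (b.toNNReal : WithTop ℝ≥0) < T₁)
    (hb₂ : (b.toNNReal : WithTop ℝ≥0) < T₂) :
    g₂ b - g₁ b = (z₂ - z₁) *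
      Complex.exp (∫ s in (0 : ℝ)..b, -2 / ((g₂ s - W s.toNNReal) * (g₁ s - W s.toNNReal))) := by
  set A : ℝ → ℂ := fun s ↦ -2 / ((g₂ s - W s.toNNReal) * (g₁ s - W s.toNNReal)) with hAdef
  have hA : ContinuousOn A (Icc 0 b) := h₁.continuousOn_coeff hW h₂ hb₁ hb₂
  -- a continuous extension of `A` beyond `[0, b]`
  set Â : ℝ → ℂ := IccExtend hb0 ((Icc 0 b).restrict A) with hÂdef
  have hÂc : Continuous Â := (continuousOn_iff_continuous_restrict.1 hA).Icc_extend'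
  have hÂA : ∀ s ∈ Icc 0 b, Â s = A s := fun s hs ↦ by
    rw [hÂdef, IccExtend_of_mem hb0 _ hs]; rfl
  -- `F u = ∫₀ᵘ Â`, `E u = exp (-F u)`
  set F : ℝ → ℂ := fun u ↦ ∫ s in (0 : ℝ)..u, Â s with hFdef
  have hF : ∀ u, HasDerivAt F (Â u) u := fun u ↦ (hÂc.integral_hasStrictDerivAt 0 u).hasDerivAt
  have hFc : Continuous F := continuous_iff_continuousAt.2 fun u ↦ (hF u).continuousAt
  have hE : ∀ u, HasDerivAt (fun u ↦ Complex.exp (-F u)) (Complex.exp (-F u) * -Â u) u :=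
    fun u ↦ (hF u).neg.cexp
  -- the product `P = (g₂ - g₁) · E` has zero right derivative on `[0, b)`
  have hsub₁ := Icc_subset_timeDomain (T := T₁) hb₁
  have hsub₂ := Icc_subset_timeDomain (T := T₂) hb₂
  have hP : ∀ u ∈ Ico 0 b,
      HasDerivWithinAt (fun u ↦ (g₂ u - g₁ u) * Complex.exp (-F u)) 0 (Ici u) u := by
    intro u hu
    have hd₁ := h₁.hasDerivWithinAt_Ici hsub₁ u hu
    have hd₂ := h₂.hasDerivWithinAt_Ici hsub₂ u hu
    have hprod := (hd₂.sub hd₁).mul (hE u).hasDerivWithinAt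
    refine hprod.congr_deriv ?_
    simp only [Pi.sub_apply]
    have hne₁ : g₁ u - W u.toNNReal ≠ 0 := sub_ne_zero.2 (h₁.ne hu.1 (hsub₁ ⟨hu.1, hu.2.le⟩).2)
    have hne₂ : g₂ u - W u.toNNReal ≠ 0 := sub_ne_zero.2 (h₂.ne hu.1 (hsub₂ ⟨hu.1, hu.2.le⟩).2)
    rw [hÂA u ⟨hu.1, hu.2.le⟩, hAdef, vectorField_apply, vectorField_apply]
    field_simp
    ring
  have hPc : ContinuousOn (fun u ↦ (g₂ u - g₁ u) * Complex.exp (-F u)) (Icc 0 b) :=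
    ((h₂.continuousOn.mono hsub₂).sub (h₁.continuousOn.mono hsub₁)).mul
      (Complex.continuous_exp.comp hFc.neg).continuousOn
  have hconst := constant_of_has_deriv_right_zero hPc hP b ⟨hb0, le_rfl⟩
  have hF0 : F 0 = 0 := intervalIntegral.integral_same
  simp only [hF0, neg_zero, Complex.exp_zero, mul_one, h₁.apply_zero, h₂.apply_zero] at hconst
  -- `hconst : (g₂ b - g₁ b) * exp (-F b) = z₂ - z₁`
  have hFb : F b = ∫ s in (0 : ℝ)..b, A s :=
    intervalIntegral.integral_congr fun s hs ↦ hÂA s (by rwa [uIcc_of_le hb0] at hs)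
  rw [← hFb]
  calc g₂ b - g₁ b = (g₂ b - g₁ b) * Complex.exp (-F b) * Complex.exp (F b) := by
        rw [mul_assoc, ← Complex.exp_add, neg_add_cancel, Complex.exp_zero, mul_one]
    _ = (z₂ - z₁) * Complex.exp (F b) := by rw [hconst]

end Difference

/-! ### The Loewner map in the starting point: injective, holomorphic -/

section Deriv

/-- `(↑t : ℝ).toNNReal < T_z` from `↑t < T_z`. [folklore] -/
theorem toNNReal_coe_lt {t : ℝ≥0} {T' : WithTop ℝ≥0} (h : (t : WithTop ℝ≥0) < T') :
    (((t : ℝ)).toNNReal : WithTop ℝ≥0) < T' := by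
  rwa [Real.toNNReal_coe]

/-- **The Loewner map `g_t` is injective** on `{z | t < T_z}` (continuous driving function): by
`IsSolution.sub_eq_mul_exp`, `g_t(z₂) - g_t(z₁) = (z₂ - z₁) e^{∫ a} ≠ 0` for `z₁ ≠ z₂`.
Lawler (2005), Ch. 4 §4.1, Thm. 4.6 and eq. (4.6) (the `g_t` are one-to-one).
[cite: Lawler2005, Thm. 4.6] -/
theorem injOn_map_of_lt_swallowingTime (hW : Continuous W) (t : ℝ≥0) :
    InjOn (map W t) {z : ℂ | (t : WithTop ℝ≥0) < swallowingTime W z} := by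
  intro z₁ hz₁ z₂ hz₂ heq
  obtain ⟨g₁, hg₁⟩ :=
    exists_isSolution_swallowingTime_holds hW (ne_driving_of_lt_swallowingTime hz₁)
  obtain ⟨g₂, hg₂⟩ :=
    exists_isSolution_swallowingTime_holds hW (ne_driving_of_lt_swallowingTime hz₂)
  rw [map_eq_of_isSolution hW hg₁ hz₁, map_eq_of_isSolution hW hg₂ hz₂] at heq
  have hid := hg₁.sub_eq_mul_exp hW hg₂ t.coe_nonneg (toNNReal_coe_lt hz₁) (toNNReal_coe_lt hz₂)
  rw [heq, sub_self] at hid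
  by_contra hne
  exact (mul_ne_zero (sub_ne_zero.2 (Ne.symm hne)) (Complex.exp_ne_zero _)) hid.symm

/-- **The Loewner map is complex differentiable**, with the explicit derivative
`g_t'(z) = exp (-∫₀ᵗ 2/(g_s(z) - W_s)² ds)`: by `IsSolution.sub_eq_mul_exp` the difference
quotient `(g_t(y) - g_t(z))/(y - z)` equals `exp ∫₀ᵗ a_y` with
`a_y = -2/((g_s(y) - W_s)(g_s(z) - W_s))`, and `a_y → -2/(g_s(z) - W_s)²` uniformly on `[0, t]`
as `y → z` by continuous dependence (`IsSolution.exists_forall_dist_lt`; the solutions stay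
`δ/2`-away from `W`). Lawler (2005), Ch. 4 §4.1 (`g_t` is a conformal transformation; cf. the
formula `∂_t log g_t' = -2/(g_t - U_t)²`). [cite: Lawler2005, Ch. 4 §4.1] -/
theorem hasDerivAt_map (hW : Continuous W) {t : ℝ≥0}
    (hz : (t : WithTop ℝ≥0) < swallowingTime W z) (hg : IsSolution W z g (swallowingTime W z)) :
    HasDerivAt (map W t)
      (Complex.exp (∫ s in (0 : ℝ)..t, -2 / ((g s - W s.toNNReal) * (g s - W s.toNNReal)))) z := by
  set I₀ := ∫ s in (0 : ℝ)..t, -2 / ((g s - W s.toNNReal) * (g s - W s.toNNReal)) with hI₀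
  rw [hasDerivAt_iff_tendsto_slope, Metric.tendsto_nhdsWithin_nhds]
  intro ε hε
  obtain ⟨κ, hκ, hκε⟩ := Metric.continuousAt_iff.1
    (Complex.continuous_exp.continuousAt (x := I₀)) ε hε
  have htT := toNNReal_coe_lt hz
  obtain ⟨δ, hδ, hfar⟩ := hg.exists_le_norm_sub hW t.coe_nonneg htT
  have hδ' : (0 : ℝ) < δ := hδ
  -- tolerance `η` for the nearby solutions
  set η : ℝ := min (δ / 2) (κ * δ ^ 3 / (8 * (t + 1))) with hηdef
  have hη : 0 < η := lt_min (half_pos hδ') (by positivity)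
  have hηδ : η ≤ δ / 2 := min_le_left _ _
  have hηκ : η ≤ κ * δ ^ 3 / (8 * (t + 1)) := min_le_right _ _
  obtain ⟨ρ, hρ, hdep⟩ := hg.exists_forall_dist_lt hW hz hη
  refine ⟨ρ, hρ, fun {y} hy hyz ↦ ?_⟩
  obtain ⟨hyT, hclose⟩ := hdep y hyz
  obtain ⟨g', hg'⟩ :=
    exists_isSolution_swallowingTime_holds hW (ne_driving_of_lt_swallowingTime hyT)
  have hyT' := toNNReal_coe_lt hyT
  set I := ∫ s in (0 : ℝ)..t, -2 / ((g' s - W s.toNNReal) * (g s - W s.toNNReal)) with hI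
  have hslope : slope (map W t) z y = Complex.exp I := by
    rw [slope_def_field, map_eq_of_isSolution hW hg hz, map_eq_of_isSolution hW hg' hyT,
      hg.sub_eq_mul_exp hW hg' t.coe_nonneg htT hyT']
    have hyz0 : y - z ≠ 0 := sub_ne_zero.2 hy
    rw [← hI]
    exact mul_div_cancel_left₀ _ hyz0
  rw [hslope]
  apply hκε
  -- `dist I I₀ < κ`: the integrands are uniformly `4η/δ³`-close
  have hint₁ : IntervalIntegrable (fun s ↦ -2 / ((g' s - W s.toNNReal) * (g s - W s.toNNReal)))
      MeasureTheory.volume 0 t :=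
    ((hg.continuousOn_coeff hW hg' htT hyT').mono
      (by rw [uIcc_of_le t.coe_nonneg])).intervalIntegrable
  have hint₀ : IntervalIntegrable (fun s ↦ -2 / ((g s - W s.toNNReal) * (g s - W s.toNNReal)))
      MeasureTheory.volume 0 t :=
    ((hg.continuousOn_coeff hW hg htT htT).mono
      (by rw [uIcc_of_le t.coe_nonneg])).intervalIntegrable
  rw [dist_eq_norm, hI, hI₀, ← intervalIntegral.integral_sub hint₁ hint₀]
  have hbound : ∀ s ∈ Set.uIoc (0 : ℝ) t,
      ‖-2 / ((g' s - W s.toNNReal) * (g s - W s.toNNReal)) -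
        -2 / ((g s - W s.toNNReal) * (g s - W s.toNNReal))‖ ≤ 4 * η / δ ^ 3 := by
    intro s hs
    rw [uIoc_of_le t.coe_nonneg] at hs
    set u := g' s - W s.toNNReal with hu
    set v := g s - W s.toNNReal with hv
    have hvδ : (δ : ℝ) ≤ ‖v‖ := hfar s ⟨hs.1.le, hs.2⟩
    have hsT : (s.toNNReal : WithTop ℝ≥0) < swallowingTime W y :=
      lt_of_le_of_lt (WithTop.coe_le_coe.2 (Real.toNNReal_le_toNNReal hs.2)) hyT'
    have huv : ‖u - v‖ < η := by
      have := hclose g' _ hg' s hs.1.le hs.2 hsT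
      rw [dist_eq_norm] at this
      rwa [hu, hv, show g' s - (W s.toNNReal : ℂ) - (g s - W s.toNNReal) = g' s - g s by ring]
    have huδ : (δ : ℝ) / 2 ≤ ‖u‖ := by
      have := norm_sub_norm_le v u
      rw [norm_sub_rev] at huv
      linarith
    have hu0 : u ≠ 0 := norm_pos_iff.1 (lt_of_lt_of_le (half_pos hδ') huδ)
    have hv0 : v ≠ 0 := norm_pos_iff.1 (lt_of_lt_of_le hδ' hvδ)
    have hid : -2 / (u * v) - -2 / (v * v) = 2 * (u - v) / (u * v ^ 2) := by
      field_simp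
      ring
    rw [hid, norm_div, norm_mul, norm_mul, norm_pow, Complex.norm_two,
      div_le_div_iff₀ (by positivity) (by positivity)]
    have hv2 : (δ : ℝ) ^ 2 ≤ ‖v‖ ^ 2 := pow_le_pow_left₀ hδ'.le hvδ 2
    calc 2 * ‖u - v‖ * (δ : ℝ) ^ 3 ≤ 2 * η * (δ : ℝ) ^ 3 := by gcongr
      _ = 4 * η * ((δ : ℝ) / 2 * (δ : ℝ) ^ 2) := by ring
      _ ≤ 4 * η * (‖u‖ * ‖v‖ ^ 2) := by gcongr
  calc ‖∫ s in (0 : ℝ)..t, (-2 / ((g' s - W s.toNNReal) * (g s - W s.toNNReal)) -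
          -2 / ((g s - W s.toNNReal) * (g s - W s.toNNReal)))‖
        ≤ 4 * η / δ ^ 3 * |(t : ℝ) - 0| := intervalIntegral.norm_integral_le_of_norm_le_const hbound
    _ = 4 * η * t / δ ^ 3 := by rw [sub_zero, abs_of_nonneg t.coe_nonneg]; ring
    _ ≤ 4 * (κ * δ ^ 3 / (8 * (t + 1))) * t / δ ^ 3 := by gcongr
    _ = κ * (t / (2 * (t + 1))) := by field_simp; ring
    _ < κ := by
        refine mul_lt_of_lt_one_right hκ ?_
        rw [div_lt_one (by positivity)]
        linarith [t.coe_nonneg]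

/-- The Loewner map is holomorphic on `{z | t < T_z}` (continuous driving function).
Lawler (2005), Ch. 4 §4.1. [cite: Lawler2005, Ch. 4 §4.1] -/
theorem differentiableOn_map_of_lt_swallowingTime (hW : Continuous W) (t : ℝ≥0) :
    DifferentiableOn ℂ (map W t) {z : ℂ | (t : WithTop ℝ≥0) < swallowingTime W z} := by
  intro z hz
  obtain ⟨g, hg⟩ := exists_isSolution_swallowingTime_holds hW (ne_driving_of_lt_swallowingTime hz)
  exact (hasDerivAt_map hW hz hg).differentiableAt.differentiableWithinAt

/-- The Loewner map has a **non-vanishing strict derivative** at every point still flowing at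
time `t` (the derivative is an exponential, `hasDerivAt_map`; strictness from analyticity on
the open set `{z | t < T_z}`). [cite: Lawler2005, Ch. 4 §4.1] -/
theorem exists_hasStrictDerivAt_map (hW : Continuous W) {t : ℝ≥0}
    (hz : (t : WithTop ℝ≥0) < swallowingTime W z) :
    ∃ c : ℂ, c ≠ 0 ∧ HasStrictDerivAt (map W t) c z := by
  obtain ⟨g, hg⟩ := exists_isSolution_swallowingTime_holds hW (ne_driving_of_lt_swallowingTime hz)
  refine ⟨Complex.exp (∫ s in (0 : ℝ)..t, -2 / ((g s - W s.toNNReal) * (g s - W s.toNNReal))),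
    Complex.exp_ne_zero _, ?_⟩
  have han : AnalyticAt ℂ (map W t) z :=
    (differentiableOn_map_of_lt_swallowingTime hW t).analyticAt
      ((isOpen_setOf_lt_swallowingTime hW t).mem_nhds hz)
  exact (han.contDiffAt (n := 1)).hasStrictDerivAt' (hasDerivAt_map hW hz hg) one_ne_zero

/-- The Loewner map is continuous at every point still flowing at time `t`. [folklore] -/
theorem continuousAt_map (hW : Continuous W) {t : ℝ≥0}
    (hz : (t : WithTop ℝ≥0) < swallowingTime W z) : ContinuousAt (map W t) z := by
  obtain ⟨g, hg⟩ := exists_isSolution_swallowingTime_holds hW (ne_driving_of_lt_swallowingTime hz)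
  exact (hasDerivAt_map hW hz hg).continuousAt

end Deriv

/-! ### Imaginary parts along the flow -/

section ImDecrease

/-- Along the flow of a point of `ℍₒ` the imaginary part does not increase:
`im (g_t z) ≤ im z` (`IsSolution.im_antitoneOn` of `LoewnerFlow`). Lawler (2005), Ch. 4 §4.1,
eq. (4.5). [cite: Lawler2005, Ch. 4 §4.1] -/
theorem im_map_le (hW : Continuous W) {t : ℝ≥0} (hzH : 0 < z.im)
    (hzT : (t : WithTop ℝ≥0) < swallowingTime W z) : (map W t z).im ≤ z.im := by
  obtain ⟨g, hg⟩ := exists_isSolution_swallowingTime_holds hW (ne_driving_of_lt_swallowingTime hzT)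
  rw [map_eq_of_isSolution hW hg hzT]
  have h0 : (0 : ℝ) ∈ {s : ℝ | 0 ≤ s ∧ (s.toNNReal : WithTop ℝ≥0) < swallowingTime W z} :=
    ⟨le_rfl, by simpa using lt_of_le_of_lt bot_le hzT⟩
  have := hg.im_antitoneOn hW hzH h0 ⟨t.coe_nonneg, toNNReal_coe_lt hzT⟩ t.coe_nonneg
  simpa [hg.apply_zero] using this

end ImDecrease

/-! ### The radius of the hull about the driving point (Lawler's Lemma 4.13, sharp form) -/

section HullRadius

/-- **Translation invariance of the Loewner equation**: translating the driving function, the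
starting point and the solution by the same real `a`. [cite: Lawler2005, Ch. 4 §4.1] -/
theorem IsSolution.add_const (h : IsSolution W z g T) (a : ℝ) :
    IsSolution (fun s ↦ W s + a) (z + a) (fun t ↦ g t + a) T := by
  refine ⟨by simp only [h.apply_zero], fun t ht ↦ ?_, fun t ht htT heq ↦ ?_⟩
  · have h1 := (h.isIntegralCurveOn t ht).add_const (a : ℂ)
    convert h1 using 1
    rw [vectorField_apply, vectorField_apply]
    push_cast
    ring
  · exact h.ne ht htT (by
      have := congrArg (· - (a : ℂ)) heq
      simpa using this)

/-- Translation invariance of swallowing times. [cite: Lawler2005, Ch. 4 §4.1] -/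
theorem swallowingTime_add_const (W : ℝ≥0 → ℝ) (z : ℂ) (a : ℝ) :
    swallowingTime (fun s ↦ W s + a) (z + a) = swallowingTime W z := by
  apply le_antisymm
  · refine sSup_le fun T ⟨g, hg⟩ ↦ ?_
    have h1 := (hg.add_const (-a)).le_swallowingTime
    simp only [add_neg_cancel_right, Complex.ofReal_neg] at h1
    exact h1
  · refine sSup_le fun T ⟨g, hg⟩ ↦ ?_
    exact (hg.add_const a).le_swallowingTime

/-- **A point swallowed by time `u` lies within `sup_{s ≤ u} |W_s - W_0| + 4√u` of the
driving point `W_0`** — any point `z ≠ W_0` of the plane, real points included (continuous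
driving function; Lawler (2005), Lemma 4.13: `rad(K_t) ≤ 4 max{√t, sup_{s≤t}|U_s - U_0|}`).
Proof: a point at distance `≥ S + 2δ` from `W_0`, `δ = 2√u`, is still flowing at time `u`
(`lt_swallowingTime_of_far` of `LoewnerGrowth`, first-exit argument).
[cite: Lawler2005, Lemma 4.13] -/
theorem norm_sub_driving_le_of_swallowingTime_le (hW : Continuous W) {u : ℝ≥0} {S : ℝ}
    (hS : ∀ s : ℝ≥0, s ≤ u → |W s - W 0| ≤ S) {z : ℂ} (hz0 : z ≠ W 0)
    (hzu : swallowingTime W z ≤ u) : ‖z - W 0‖ ≤ S + 4 * Real.sqrt u := by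
  rcases eq_or_ne u 0 with rfl | hu
  · have := swallowingTime_pos_holds hW hz0
    exact absurd hzu (not_le.2 (by simpa using this))
  by_contra hgt
  rw [not_le] at hgt
  have hu' : (0 : ℝ) < u := NNReal.coe_pos.2 (pos_iff_ne_zero.2 hu)
  have hδ : 0 < 2 * Real.sqrt u := by positivity
  have hδt : 4 * (u : ℝ) ≤ (2 * Real.sqrt u) ^ 2 := by
    rw [mul_pow, Real.sq_sqrt hu'.le]
    norm_num
  have hM : ∀ s ∈ Icc (0 : ℝ) u, ‖((W s.toNNReal : ℝ) : ℂ) - (W 0 : ℂ)‖ ≤ S := by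
    intro s hs
    rw [← Complex.ofReal_sub, Complex.norm_real, Real.norm_eq_abs]
    refine hS _ ?_
    rw [← NNReal.coe_le_coe, Real.coe_toNNReal _ hs.1]
    exact hs.2
  have hfar : S + 2 * (2 * Real.sqrt u) ≤ ‖z - W 0‖ := by linarith
  exact absurd hzu (not_le.2 (lt_swallowingTime_of_far hW hM hδ hδt hfar).1)

/-- **The hull at time `u` lies within `sup_{s ≤ u} |W_s - W_0| + 4√u` of the driving point
`W_0`** (`norm_sub_driving_le_of_swallowingTime_le` for points of the hull, which are off the
real driving point). In particular `K_u → W_0` as `u → 0`. Lawler (2005), Lemma 4.13.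
[cite: Lawler2005, Lemma 4.13] -/
theorem norm_sub_driving_le_of_mem_hull (hW : Continuous W) {u : ℝ≥0} {S : ℝ}
    (hS : ∀ s : ℝ≥0, s ≤ u → |W s - W 0| ≤ S) {z : ℂ} (hz : z ∈ hull W u) :
    ‖z - W 0‖ ≤ S + 4 * Real.sqrt u := by
  refine norm_sub_driving_le_of_swallowingTime_le hW hS (fun h0 ↦ ?_) hz.2
  have : (0 : ℝ) < z.im := hz.1
  rw [h0, Complex.ofReal_im] at this
  exact lt_irrefl _ this

/-- The hull at time `u` lies in the closed disc about the driving point `W 0` of radius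
`sup_{s ≤ u}|W_s - W_0| + 4√u`. [cite: Lawler2005, Lemma 4.13] -/
theorem hull_subset_closedBall_driving (hW : Continuous W) {u : ℝ≥0} {S : ℝ}
    (hS : ∀ s : ℝ≥0, s ≤ u → |W s - W 0| ≤ S) :
    hull W u ⊆ closedBall (W 0 : ℂ) (S + 4 * Real.sqrt u) := fun _ hz ↦
  mem_closedBall_iff_norm.2 (norm_sub_driving_le_of_mem_hull hW hS hz)

end HullRadius

/-! ### Reflection `z ↦ -z̄` of hulls and generating curves -/

section NegConj

/-- `z ↦ -z̄` is an involution. [folklore] -/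
theorem negConj_negConj (z : ℂ) : -conj (-conj z) = z := by simp

/-- `z ↦ -z̄` preserves the open upper half-plane. [folklore] -/
theorem negConj_mem_upperHalfPlaneSet {z : ℂ} :
    -conj z ∈ upperHalfPlaneSet ↔ z ∈ upperHalfPlaneSet := by
  change 0 < (-conj z).im ↔ 0 < z.im
  simp

/-- `z ↦ -z̄` preserves norms, hence boundedness. [folklore] -/
theorem isBounded_image_negConj {s : Set ℂ} :
    Bornology.IsBounded ((fun z ↦ -conj z) '' s) ↔ Bornology.IsBounded s := by
  constructor
  · intro h
    have : s = (fun z ↦ -conj z) '' ((fun z ↦ -conj z) '' s) := by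
      rw [image_image]; simp
    rw [this]
    obtain ⟨R, hR⟩ := h.subset_closedBall 0
    exact (isBounded_closedBall (x := (0 : ℂ)) (r := R)).subset fun w ⟨w', hw', hw⟩ ↦ by
      have := hR hw'
      rw [mem_closedBall, dist_zero_right] at this ⊢
      rw [← hw]; simpa using this
  · intro h
    obtain ⟨R, hR⟩ := h.subset_closedBall 0
    exact (isBounded_closedBall (x := (0 : ℂ)) (r := R)).subset fun w ⟨w', hw', hw⟩ ↦ by
      have := hR hw'
      rw [mem_closedBall, dist_zero_right] at this ⊢
      rw [← hw]; simpa using this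

/-- The hulls of the reflected chain (driving function `-W`) are the reflected hulls.
[cite: Lawler2005, Ch. 4 §4.1] -/
theorem hull_neg (W : ℝ≥0 → ℝ) (t : ℝ≥0) :
    hull (fun s ↦ -W s) t = (fun z ↦ -conj z) '' hull W t := by
  ext z
  constructor
  · rintro ⟨hz, hzt⟩
    refine ⟨-conj z, ⟨negConj_mem_upperHalfPlaneSet.2 hz, ?_⟩, negConj_negConj z⟩
    rwa [← swallowingTime_neg_conj W (-conj z), negConj_negConj] 
  · rintro ⟨w, ⟨hw, hwt⟩, rfl⟩
    exact ⟨negConj_mem_upperHalfPlaneSet.2 hw, by rwa [swallowingTime_neg_conj]⟩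

/-- The unbounded components commute with the reflection `z ↦ -z̄` (a homeomorphism preserving
boundedness; Mathlib `Homeomorph.image_connectedComponentIn` for `conjLIE.toHomeomorph.trans neg`).
[folklore] -/
theorem unboundedComponent_image_negConj (U : Set ℂ) :
    unboundedComponent ((fun z ↦ -conj z) '' U) = (fun z ↦ -conj z) '' unboundedComponent U := by
  ext z
  constructor
  · rintro ⟨⟨w, hwU, rfl⟩, hunb⟩
    refine ⟨w, ⟨hwU, fun hb ↦ hunb ?_⟩, rfl⟩
    have := (Complex.conjLIE.toHomeomorph.trans (Homeomorph.neg ℂ)).image_connectedComponentIn hwU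
    change (fun z ↦ -conj z) '' connectedComponentIn U w =
      connectedComponentIn ((fun z ↦ -conj z) '' U) (-conj w) at this
    show Bornology.IsBounded (connectedComponentIn ((fun z ↦ -conj z) '' U) (-conj w))
    rw [← this]
    exact isBounded_image_negConj.2 hb
  · rintro ⟨w, ⟨hwU, hunb⟩, rfl⟩
    refine ⟨⟨w, hwU, rfl⟩, fun hb ↦ hunb ?_⟩
    have := (Complex.conjLIE.toHomeomorph.trans (Homeomorph.neg ℂ)).image_connectedComponentIn hwU
    change (fun z ↦ -conj z) '' connectedComponentIn U w =
      connectedComponentIn ((fun z ↦ -conj z) '' U) (-conj w) at this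
    change Bornology.IsBounded (connectedComponentIn ((fun z ↦ -conj z) '' U) (-conj w)) at hb
    rw [← this] at hb
    exact isBounded_image_negConj.1 hb

/-- **Reflection of generating curves**: if the chain driven by `W` is generated by `γ`, the chain
driven by `-W` is generated by `-γ̄`. [cite: Lawler2005, Ch. 4 §4.1] -/
theorem IsGeneratedByCurve.neg_conj {γ : ℝ≥0 → ℂ} (h : IsGeneratedByCurve W γ) :
    IsGeneratedByCurve (fun s ↦ -W s) (fun t ↦ -conj (γ t)) := by
  refine ⟨(Complex.continuous_conj.comp h.continuous).neg, by simp [h.apply_zero], fun t ↦ ?_,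
    fun t ↦ ?_⟩
  · simpa using h.im_nonneg t
  · have hinj : Function.Injective (fun z : ℂ ↦ -conj z) := fun a b hab ↦ by
      simpa using congrArg (fun z ↦ -conj z) hab
    rw [hull_neg, h.hull_eq t, image_sdiff hinj, ← unboundedComponent_image_negConj,
      image_sdiff hinj]
    congr 2
    · ext z
      constructor
      · rintro ⟨w, hw, rfl⟩; exact negConj_mem_upperHalfPlaneSet.2 hw
      · intro hz; exact ⟨-conj z, negConj_mem_upperHalfPlaneSet.2 hz, negConj_negConj z⟩
    · congr 1
      · ext z
        constructor
        · rintro ⟨w, hw, rfl⟩; exact negConj_mem_upperHalfPlaneSet.2 hw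
        · intro hz; exact ⟨-conj z, negConj_mem_upperHalfPlaneSet.2 hz, negConj_negConj z⟩
      · rw [image_image]

end NegConj

/-! ### Hulls grow strictly: `K_s ≠ K_t` for `s < t` -/

section Growth

/-- **The hulls grow strictly**: `K_s ≠ K_t` for `s < t` and a continuous driving function —
the `≠` form of `hull_ssubset_hull` of `LoewnerGrowth` (`K_r ≠ ∅` for `r > 0` by the rigidity
of hydrodynamically normalised automorphisms of `ℍₒ`, transported by the cocycle `map_add`;
Lawler (2005), Thm. 4.6: `hcap(K_t) = 2t`). This is the deterministic input "the trace cannot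
crawl along the real axis without growing the hull" of
`Literature.Probability.RandomPlanarGeometry.sle_swallowingTime_ofReal_eq_firstHit` (`SLEBoundaryHitting`). [cite: Lawler2005, Thm. 4.6] -/
theorem hull_ne_hull (hW : Continuous W) {s t : ℝ≥0} (hst : s < t) :
    hull W s ≠ hull W t :=
  (hull_ssubset_hull hW hst).ne

end Growth

end Loewner

end Literature.Probability.RandomPlanarGeometry
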